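import Summits.Ventures.HSemireg.UntwistCocycleTwist
import Literature.AlgebraicGeometry.Modules.PullbackAffineChart
import HarnessLib

/-!
# The extension of `𝒪_X`-modules glued from a Čech `1`-cocycle of local morphisms

For a scheme `X`, a point-indexed open cover `(U_x)_{x ∈ X}` (the cover `c.U` of a unit cocycle `c`, as in
`UntwistCocycleTwist.lean`), `𝒪_X`-modules `A`, `B` and a **`1`-cocycle of local morphisms**
`w = (w_{xy} : A|_V ⟶ B|_V)_{V ⊆ U_x ∩ U_y}` (compatible with restriction; `w_{xz} = w_{xy} + w_{yz}` on triple
overlaps — `LocalOneCocycle`), we construct the `𝒪_X`-module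

  `ext w` : sections over `V` = pairs `(a, (β_x)_x)`, `a ∈ Γ(A, V)`, `β_x ∈ Γ(B, V ∩ U_x)`, with
  `β_x|_W - β_y|_W = w_{xy}(a|_W)` for all `W ⊆ V ∩ U_x ∩ U_y`

(a sheaf: `isSheaf_extSubmodule`), by the gluing pattern of th-4's `CocycleTwist.twist` (submodule of the product of the
pieces, `CocycleTwist.piModule`).  It is an extension `0 → B → ext w → A → 0` which SPLITS over every `U_x` (by
`(a, β) ↦ β_x`) with difference of splittings the cocycle `w` — the sequel `CocycleExtensionExact.lean` records
`ι`, `π`, the local retractions and short exactness.  Example (the one the cell needs): `A = Ωʲ`, `B = Ωʲ⁺¹`,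
`w_{xy} = d log g_{xy} ∧ –` for a unit cocycle `(g_{xy})`: the extension by which «cup product with the Atiyah class
of the line bundle `[c]`» acts on complexes `K• ⊗ Ωʲ` (brick C2b of general-structure/COMPLEX-LEIBNIZ-PLAN-gs-g4.md).

HONEST FRAMING (cell pub-hsemireg, seat gs-g4): module-level sheaf algebra on real carriers; NOT a door, NOT a named
fact; nothing here says HC, HC_CM or HC_AV is proved.

## References
* R. Hartshorne, *Algebraic Geometry*, GTM 52 (1977), II Ex. 1.22 (glueing sheaves), III.4 (Čech cocycles). [Hartshorne1977]
* The Stacks Project, Tag 00AK (glueing sheaves). [StacksProject]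
-/

noncomputable section

set_option backward.isDefEq.respectTransparency false

open CategoryTheory AlgebraicGeometry TopologicalSpace Opposite

namespace Summit.Ventures.HSemireg

open Literature.AlgebraicGeometry.Modules CocycleTwist

universe u

variable {X : Scheme.{u}} (c : UnitCocycle X) (A B : X.Modules)

/-- Restriction along the identity. [folklore] -/
theorem presheaf_map_id_apply (M : X.Modules) (V : X.Opens) (m : Γ(M, V)) : M.presheaf.map (𝟙 V).op m = m := by
  rw [op_id, M.presheaf.map_id]; rfl

/-- Values of a difference of local morphisms. [folklore] -/
theorem appLE_sub_left {E M : X.Modules} {U W : X.Opens} (φ ψ : E.over U ⟶ M.over U) (k : W ⟶ U) (s : Γ(E, W)) :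
    appLE (φ - ψ) k s = appLE φ k s - appLE ψ k s := by
  rw [sub_eq_add_neg, appLE_add, sub_eq_add_neg]
  rfl

/-- **A Čech `1`-cocycle of local morphisms `A → B` on the cover of `c`**: for every open `V ⊆ U_x ∩ U_y` a morphism
`w_{xy,V} : A|_V ⟶ B|_V`, compatible with restriction, additive on triple overlaps (`w_{xz} = w_{xy} + w_{yz}`).
[cite: Hartshorne1977, III.4 (Čech cochains)] -/
structure LocalOneCocycle where
  /-- the local morphisms `w_{xy,V} : A|_V ⟶ B|_V`, `V ⊆ U_x ∩ U_y` -/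
  w : ∀ (x y : X) (V : X.Opens), V ≤ c.U x → V ≤ c.U y → (A.over V ⟶ B.over V)
  /-- compatibility with restriction -/
  restrictHom_w : ∀ (x y : X) {V W : X.Opens} (hx : V ≤ c.U x) (hy : V ≤ c.U y) (i : W ⟶ V),
    restrictHom i (w x y V hx hy) = w x y W (i.le.trans hx) (i.le.trans hy)
  /-- the cocycle condition on triple overlaps -/
  w_cocycle : ∀ (x y z : X) (V : X.Opens) (hx : V ≤ c.U x) (hy : V ≤ c.U y) (hz : V ≤ c.U z),
    w x z V hx hz = w x y V hx hy + w y z V hy hz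

namespace LocalOneCocycle

variable {c A B} (w : LocalOneCocycle c A B)

/-- `w_{xx} = 0`. [folklore] -/
theorem w_self (x : X) (V : X.Opens) (hx : V ≤ c.U x) : w.w x x V hx hx = 0 := by
  have h := w.w_cocycle x x x V hx hx hx
  exact (left_eq_add.mp h)

/-- `w_{yx} = -w_{xy}`. [folklore] -/
theorem w_symm (x y : X) (V : X.Opens) (hx : V ≤ c.U x) (hy : V ≤ c.U y) : w.w y x V hy hx = -w.w x y V hx hy := by
  have h := w.w_cocycle x y x V hx hy hx
  rw [w_self] at h
  exact eq_neg_of_add_eq_zero_right h.symm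

/-- Values of `w` commute with restriction: `(w_{xy} a)|_W = w_{xy}(a|_W)`. [folklore] -/
theorem map_appLE_w (x y : X) {V W W' : X.Opens} (hx : V ≤ c.U x) (hy : V ≤ c.U y) (k : W ⟶ V) (l : W' ⟶ W)
    (a : Γ(A, W)) :
    B.presheaf.map l.op (appLE (w.w x y V hx hy) k a) = appLE (w.w x y V hx hy) (l ≫ k) (A.presheaf.map l.op a) :=
  (appLE_map _ _ _ _).symm

end LocalOneCocycle

namespace CocycleExtension

variable {c A B} (w : LocalOneCocycle c A B)

/-! ### The carrier: pairs `(a, (β_x)_x)` -/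

/-- Pairs `(a ∈ Γ(A, V), (β_x ∈ Γ(B, V ∩ U_x))_x)`. [folklore] -/
abbrev PairFamily (V : X.Opens) : Type u := Γ(A, V) × PointFamily c B V

/-- The `𝒪_X(V)`-module structure on pair families (componentwise; the point-family factor as in
`CocycleTwist.PointFamily.module`). [folklore] -/
@[reducible]
def PairFamily.module (V : X.Opens) : Module Γ(X, V) (PairFamily (c := c) (A := A) (B := B) V) :=
  letI := PointFamily.module c B V
  inferInstance

/-- Restriction of pair families. [folklore] -/
def PairFamily.res {V W : X.Opens} (h : W ≤ V) (p : PairFamily (c := c) (A := A) (B := B) V) :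
    PairFamily (c := c) (A := A) (B := B) W :=
  (A.presheaf.map (homOfLE h).op p.1, PointFamily.res c B h p.2)

/-- The presheaf of abelian groups of pair families. [folklore] -/
def pairPresheafAb : TopCat.Presheaf Ab X where
  obj V := AddCommGrpCat.of (PairFamily (c := c) (A := A) (B := B) V.unop)
  map i := AddCommGrpCat.ofHom
    { toFun := PairFamily.res i.unop.le
      map_zero' := Prod.ext (map_zero _) (funext fun _ => map_zero _)
      map_add' := fun p q => Prod.ext (map_add _ _ _) (funext fun x => map_add _ (p.2 x) (q.2 x)) }
  map_id V := by
    refine AddCommGrpCat.ext fun p => Prod.ext ?_ (funext fun x => ?_)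
    · change A.presheaf.map _ p.1 = p.1
      have : (homOfLE (𝟙 V).unop.le).op = 𝟙 (op V.unop) := Subsingleton.elim _ _
      rw [this, A.presheaf.map_id]; rfl
    · change B.presheaf.map _ (p.2 x) = p.2 x
      have : (homOfLE (inf_le_inf_right (c.U x) (𝟙 V).unop.le)).op = 𝟙 (op (V.unop ⊓ c.U x)) :=
        Subsingleton.elim _ _
      rw [this, B.presheaf.map_id]; rfl
  map_comp i i' := by
    refine AddCommGrpCat.ext fun p => Prod.ext ?_ (funext fun x => ?_)
    · change A.presheaf.map _ p.1 = A.presheaf.map _ (A.presheaf.map _ p.1)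
      rw [presheaf_map_map]; rfl
    · change B.presheaf.map _ (p.2 x) = B.presheaf.map _ (B.presheaf.map _ (p.2 x))
      rw [presheaf_map_map]; rfl

/-- The presheaf of `𝒪_X`-modules of pair families. [folklore] -/
def pairPresheaf : X.PresheafOfModules :=
  @PresheafOfModules.ofPresheaf _ _ X.ringCatSheaf.obj (pairPresheafAb (c := c) (A := A) (B := B))
    (fun V => PairFamily.module (c := c) (A := A) (B := B) V.unop)
    (fun V W i a p => by
      letI := PairFamily.module (c := c) (A := A) (B := B) V.unop
      letI := PairFamily.module (c := c) (A := A) (B := B) W.unop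
      refine Prod.ext ?_ (funext fun x => ?_)
      · exact Scheme.Modules.map_smul A i.unop a p.1
      · change B.presheaf.map (homOfLE (inf_le_inf_right (c.U x) i.unop.le)).op
            (X.presheaf.map (homOfLE (inf_le_left : V.unop ⊓ c.U x ≤ V.unop)).op a • p.2 x) =
          X.presheaf.map (homOfLE (inf_le_left : W.unop ⊓ c.U x ≤ W.unop)).op (X.presheaf.map i a) •
            B.presheaf.map (homOfLE (inf_le_inf_right (c.U x) i.unop.le)).op (p.2 x)
        rw [Scheme.Modules.map_smul, ← CategoryTheory.comp_apply, ← CategoryTheory.comp_apply,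
          ← Functor.map_comp, ← Functor.map_comp]
        rfl)

/-- `V ↦ Γ(A, V) × Π_x Γ(B, V ∩ U_x)` is a sheaf (both factors are). [folklore] -/
theorem isSheaf_pairPresheaf : TopCat.Presheaf.IsSheaf (pairPresheaf (c := c) (A := A) (B := B)).presheaf := by
  change TopCat.Presheaf.IsSheaf (pairPresheafAb (c := c) (A := A) (B := B))
  rw [TopCat.Presheaf.isSheaf_iff_isSheafUniqueGluing]
  intro κ V sf hsf
  have hA := (Scheme.Modules.isSheaf A).isSheafUniqueGluing V (fun a => ((sf a).1 : A.presheaf.obj (op (V a))))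
    fun a b => by exact congrArg Prod.fst (hsf a b)
  have hP := (Scheme.Modules.isSheaf (piModule c B)).isSheafUniqueGluing V
    (fun a => ((sf a).2 : (piModule c B).presheaf.obj (op (V a)))) fun a b => by exact congrArg Prod.snd (hsf a b)
  obtain ⟨sA, hsA, huA⟩ := hA
  obtain ⟨sP, hsP, huP⟩ := hP
  refine ⟨(sA, sP), fun a => Prod.ext ?_ ?_, fun t ht => Prod.ext (huA t.1 fun a => ?_) (huP t.2 fun a => ?_)⟩
  · have e : (Opens.leSupr V a).op = (homOfLE (le_iSup V a)).op := Subsingleton.elim _ _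
    have := hsA a; rw [e] at this; exact this
  · have e : (Opens.leSupr V a).op = (homOfLE (le_iSup V a)).op := Subsingleton.elim _ _
    have := hsP a; rw [e] at this; exact this
  · have e : (Opens.leSupr V a).op = (homOfLE (le_iSup V a)).op := Subsingleton.elim _ _
    rw [e]; exact congrArg Prod.fst (ht a)
  · have e : (Opens.leSupr V a).op = (homOfLE (le_iSup V a)).op := Subsingleton.elim _ _
    rw [e]; exact congrArg Prod.snd (ht a)

/-- The module of pair families `A × Π_x (j_x)_*(B|_{U_x})`. [folklore] -/
def pairModule : X.Modules where
  val := pairPresheaf (c := c) (A := A) (B := B)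
  isSheaf := isSheaf_pairPresheaf (c := c) (A := A) (B := B)

/-! ### The gluing relation `β_x - β_y = w_{xy}(a)` and the submodule -/

/-- **The gluing relation** of the cocycle extension: pair families with `β_x|_W - β_y|_W = w_{xy}(a|_W)` on every
`W ⊆ V ∩ U_x ∩ U_y` (a predicate; nothing asserted). [cite: Hartshorne1977, II Ex. 1.22] -/
def extFamilies (V : X.Opens) : Set (PairFamily (c := c) (A := A) (B := B) V) :=
  {p | ∀ (x y : X) ⦃W : X.Opens⦄ (hW : W ≤ V) (hx : W ≤ c.U x) (hy : W ≤ c.U y),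
    B.presheaf.map (homOfLE (le_inf hW hx)).op (p.2 x) - B.presheaf.map (homOfLE (le_inf hW hy)).op (p.2 y) =
      appLE (w.w x y W hx hy) (𝟙 W) (A.presheaf.map (homOfLE hW).op p.1)}

namespace extFamilies

variable {w} {V : X.Opens}

/-- The relation of a member. [folklore] -/
theorem rel {p : PairFamily V} (hp : p ∈ extFamilies w V) (x y : X) ⦃W : X.Opens⦄ (hW : W ≤ V)
    (hx : W ≤ c.U x) (hy : W ≤ c.U y) :
    B.presheaf.map (homOfLE (le_inf hW hx)).op (p.2 x) - B.presheaf.map (homOfLE (le_inf hW hy)).op (p.2 y) =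
      appLE (w.w x y W hx hy) (𝟙 W) (A.presheaf.map (homOfLE hW).op p.1) :=
  hp x y hW hx hy

/-- `0` satisfies the relation. [folklore] -/
theorem zero_mem : (0 : PairFamily (c := c) (A := A) (B := B) V) ∈ extFamilies w V := fun x y W hW hx hy => by
  simp only [Prod.snd_zero, Pi.zero_apply, map_zero, sub_zero, Prod.fst_zero, appLE_zero_right]

/-- The relation is stable under addition. [folklore] -/
theorem add_mem {p q : PairFamily V} (hp : p ∈ extFamilies w V) (hq : q ∈ extFamilies w V) :
    p + q ∈ extFamilies w V := fun x y W hW hx hy => by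
  simp only [Prod.snd_add, Pi.add_apply, map_add, Prod.fst_add, appLE_add_right]
  rw [← rel hp x y hW hx hy, ← rel hq x y hW hx hy]
  abel

/-- The action on pair sections, first component. [folklore] -/
theorem pair_smul_fst (a : Γ(X, V)) (p : Γ(pairModule (c := c) (A := A) (B := B), V)) :
    (a • p).1 = a • p.1 := rfl

/-- The action on pair sections, point components. [folklore] -/
theorem pair_smul_snd (a : Γ(X, V)) (p : Γ(pairModule (c := c) (A := A) (B := B), V)) (x : X) :
    (a • p).2 x = X.presheaf.map (homOfLE (inf_le_left : V ⊓ c.U x ≤ V)).op a • p.2 x := rfl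

/-- The relation is stable under the action. [folklore] -/
theorem smul_mem (a : Γ(X, V)) {p : Γ(pairModule (c := c) (A := A) (B := B), V)} (hp : p ∈ extFamilies w V) :
    a • p ∈ extFamilies w V := fun x y W hW hx hy => by
  rw [pair_smul_snd, pair_smul_snd, pair_smul_fst, Scheme.Modules.map_smul, Scheme.Modules.map_smul,
    Scheme.Modules.map_smul, ← CategoryTheory.comp_apply, ← Functor.map_comp, ← CategoryTheory.comp_apply,
    ← Functor.map_comp, appLE_smul_right, ← rel hp x y hW hx hy, smul_sub]
  rfl

/-- The relation restricts. [folklore] -/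
theorem res_mem {p : PairFamily V} (hp : p ∈ extFamilies w V) {W : X.Opens} (h : W ≤ V) :
    PairFamily.res h p ∈ extFamilies w W := fun x y W' hW' hx hy => by
  change B.presheaf.map _ (B.presheaf.map _ (p.2 x)) - B.presheaf.map _ (B.presheaf.map _ (p.2 y)) =
    appLE _ _ (A.presheaf.map _ (A.presheaf.map _ p.1))
  rw [presheaf_map_map, presheaf_map_map, presheaf_map_map]
  exact rel hp x y (hW'.trans h) hx hy

end extFamilies

/-- The families satisfying the relation form a submodule. [folklore] -/
def extSubmoduleObj (V : X.Opens) : Submodule Γ(X, V) Γ(pairModule (c := c) (A := A) (B := B), V) where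
  carrier := extFamilies w V
  zero_mem' := extFamilies.zero_mem
  add_mem' := extFamilies.add_mem
  smul_mem' := fun a _ hp => extFamilies.smul_mem a hp

/-- The relation is stable under restriction: a sub-presheaf of modules. [folklore] -/
def extSubmodule : PresheafOfModules.Submodule (pairModule (c := c) (A := A) (B := B)).val where
  obj V := extSubmoduleObj w V.unop
  map i := fun _ hp => extFamilies.res_mem hp i.unop.le

/-- Locality of the relation: a pair family over `⨆ V_a` satisfying it on every `V_a` satisfies it. [folklore] -/
theorem mem_extFamilies_of_locally {κ : Type u} (V : κ → X.Opens) (p : PairFamily (c := c) (A := A) (B := B) (iSup V))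
    (hp : ∀ a, PairFamily.res (le_iSup V a) p ∈ extFamilies w (V a)) : p ∈ extFamilies w (iSup V) := by
  intro x y W hW hx hy
  have hcov : W ≤ ⨆ a, W ⊓ V a := by
    rw [← inf_iSup_eq]
    exact le_inf le_rfl hW
  apply TopCat.Sheaf.eq_of_locally_eq' (⟨B.presheaf, Scheme.Modules.isSheaf B⟩ : TopCat.Sheaf Ab X)
    (fun a => W ⊓ V a) W (fun a => homOfLE inf_le_left) hcov
  intro a
  change B.presheaf.map _ (B.presheaf.map _ _ - B.presheaf.map _ _) = B.presheaf.map _ (appLE _ _ _)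
  rw [map_sub, presheaf_map_map, presheaf_map_map, ← appLE_map, presheaf_map_map,
    appLE_congr_hom (w.w x y W hx hy) _ (𝟙 _ ≫ homOfLE (inf_le_left : W ⊓ V a ≤ W)),
    ← appLE_restrictHom (homOfLE (inf_le_left : W ⊓ V a ≤ W)) (w.w x y W hx hy), w.restrictHom_w]
  have key := extFamilies.rel (hp a) x y (W := W ⊓ V a) inf_le_right (inf_le_left.trans hx) (inf_le_left.trans hy)
  change B.presheaf.map _ (B.presheaf.map _ _) - B.presheaf.map _ (B.presheaf.map _ _) =
    appLE _ _ (A.presheaf.map _ (A.presheaf.map _ _)) at key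
  rw [presheaf_map_map, presheaf_map_map, presheaf_map_map] at key
  exact key

/-- **`V ↦ ext w (V)` is a sheaf.** [folklore] -/
theorem isSheaf_extSubmodule : TopCat.Presheaf.IsSheaf (extSubmodule w).toPresheafOfModules.presheaf := by
  rw [TopCat.Presheaf.isSheaf_iff_isSheafUniqueGluing]
  intro κ V sf hsf
  let M := pairModule (c := c) (A := A) (B := B)
  have hsf' : TopCat.Presheaf.IsCompatible M.presheaf V fun a => (sf a).val := fun a b =>
    congrArg Subtype.val (hsf a b)
  obtain ⟨s, hs, huniq⟩ := (Scheme.Modules.isSheaf M).isSheafUniqueGluing V (fun a => (sf a).val) hsf'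
  have hmem : s ∈ extFamilies w (iSup V) :=
    mem_extFamilies_of_locally w V s fun a => by
      have e : (homOfLE (le_iSup V a)).op = (Opens.leSupr V a).op := Subsingleton.elim _ _
      have hsa := hs a
      rw [← e] at hsa
      have : PairFamily.res (le_iSup V a) s = (sf a).val := hsa
      rw [this]; exact (sf a).2
  refine ⟨⟨s, hmem⟩, fun a => Subtype.ext (hs a), fun t ht => Subtype.ext (huniq t.val fun a => ?_)⟩
  exact congrArg Subtype.val (ht a)

/-- **The cocycle extension `ext w`**: the `𝒪_X`-module of pairs `(a, (β_x)_x)` with `β_x - β_y = w_{xy}(a)`.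
[cite: Hartshorne1977, II Ex. 1.22] -/
def ext : X.Modules :=
  ⟨(extSubmodule w).toPresheafOfModules, isSheaf_extSubmodule w⟩

/-- The `A`-component `a ∈ Γ(A, V)` of a section of `ext w`. [folklore] -/
def fst {V : X.Opens} (s : Γ(ext w, V)) : Γ(A, V) := (s : extSubmoduleObj w V).val.1

/-- The `x`-component `β_x ∈ Γ(B, V ∩ U_x)` of a section of `ext w`. [folklore] -/
def comp {V : X.Opens} (s : Γ(ext w, V)) (x : X) : Γ(B, V ⊓ c.U x) := (s : extSubmoduleObj w V).val.2 x

/-- Sections of `ext w` satisfy the gluing relation `β_x - β_y = w_{xy}(a)`. [folklore] -/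
theorem comp_rel {V : X.Opens} (s : Γ(ext w, V)) (x y : X) ⦃W : X.Opens⦄ (hW : W ≤ V) (hx : W ≤ c.U x)
    (hy : W ≤ c.U y) :
    B.presheaf.map (homOfLE (le_inf hW hx)).op (comp w s x) - B.presheaf.map (homOfLE (le_inf hW hy)).op (comp w s y) =
      appLE (w.w x y W hx hy) (𝟙 W) (A.presheaf.map (homOfLE hW).op (fst w s)) :=
  (s : extSubmoduleObj w V).2 x y hW hx hy

/-- Extensionality for sections of `ext w`. [folklore] -/
@[ext]
theorem ext_ext {V : X.Opens} {s t : Γ(ext w, V)} (h₁ : fst w s = fst w t) (h₂ : ∀ x, comp w s x = comp w t x) :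
    s = t :=
  Subtype.ext (Prod.ext h₁ (funext h₂))

/-- A pair family satisfying the relation is a section of `ext w`. [folklore] -/
def mk {V : X.Opens} (p : PairFamily V) (hp : p ∈ extFamilies w V) : Γ(ext w, V) := (⟨p, hp⟩ : extSubmoduleObj w V)

/-- `A`-component of `mk`. [folklore] -/
@[simp] theorem fst_mk {V : X.Opens} (p : PairFamily V) (hp : p ∈ extFamilies w V) : fst w (mk w p hp) = p.1 := rfl
/-- Point components of `mk`. [folklore] -/
@[simp] theorem comp_mk {V : X.Opens} (p : PairFamily V) (hp : p ∈ extFamilies w V) (x : X) :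
    comp w (mk w p hp) x = p.2 x := rfl
/-- Restriction acts on the `A`-component by restriction. [folklore] -/
@[simp] theorem fst_map {V W : X.Opens} (h : W ≤ V) (s : Γ(ext w, V)) :
    fst w ((ext w).presheaf.map (homOfLE h).op s) = A.presheaf.map (homOfLE h).op (fst w s) := rfl
/-- Restriction acts on the point components by restriction. [folklore] -/
@[simp] theorem comp_map {V W : X.Opens} (h : W ≤ V) (s : Γ(ext w, V)) (x : X) :
    comp w ((ext w).presheaf.map (homOfLE h).op s) x =
      B.presheaf.map (homOfLE (inf_le_inf_right (c.U x) h)).op (comp w s x) := rfl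
/-- The action on the `A`-component. [folklore] -/
@[simp] theorem fst_smul {V : X.Opens} (a : Γ(X, V)) (s : Γ(ext w, V)) : fst w (a • s) = a • fst w s := rfl
/-- The action on the point components. [folklore] -/
@[simp] theorem comp_smul {V : X.Opens} (a : Γ(X, V)) (s : Γ(ext w, V)) (x : X) :
    comp w (a • s) x = X.presheaf.map (homOfLE (inf_le_left : V ⊓ c.U x ≤ V)).op a • comp w s x := rfl
/-- `fst` is additive. [folklore] -/
@[simp] theorem fst_add {V : X.Opens} (s t : Γ(ext w, V)) : fst w (s + t) = fst w s + fst w t := rfl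
/-- `comp` is additive. [folklore] -/
@[simp] theorem comp_add {V : X.Opens} (s t : Γ(ext w, V)) (x : X) : comp w (s + t) x = comp w s x + comp w t x := rfl
/-- `fst 0 = 0`. [folklore] -/
@[simp] theorem fst_zero {V : X.Opens} : fst w (0 : Γ(ext w, V)) = 0 := rfl
/-- `comp 0 = 0`. [folklore] -/
@[simp] theorem comp_zero {V : X.Opens} (x : X) : comp w (0 : Γ(ext w, V)) x = 0 := rfl
/-- `fst` commutes with subtraction. [folklore] -/
@[simp] theorem fst_sub {V : X.Opens} (s t : Γ(ext w, V)) : fst w (s - t) = fst w s - fst w t := rfl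
/-- `comp` commutes with subtraction. [folklore] -/
@[simp] theorem comp_sub {V : X.Opens} (s t : Γ(ext w, V)) (x : X) : comp w (s - t) x = comp w s x - comp w t x := rfl

end CocycleExtension

end Summit.Ventures.HSemireg

end
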